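import Summits.HubbardSuperconductivity.HubbardSuperconductivity.Theses.BalabanIR
import Summits.HubbardSuperconductivity.HubbardSuperconductivity.Theorems.BalabanIRBirEveryGroundStateTwoScaleTransfer

/-!
# Crux `BirEveryGroundState` (stmt-HubbardSuperconductivity-2083) — LINE `two-scale-domination`
# (payload slug `Sketch`: ideator-1 gen-2 card; skeleton rebuilt by the gen-1 line lead from the landed
# Theses-free closer `Theorems.birEveryGroundState_structural_of_twoScale`, p86567)

Composition (card two-scale-domination, seat-3 Theorems `…TwoScale.lean` p85062 / `…TwoScaleTransfer.lean`
p86567): at ANY coupling `U` of the window (no selection needed), the GS-average bound `c ≤ Y_L` plus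
* `stub_rigidity`  — BLOCK RIGIDITY: the GS-average block variance `V_{Λ,L}` of the block pair intensities
  `m_Λ(x)ᴴ m_Λ(x)` is `≤ ε` for `Λ ≥ Λ₀(ε)`, eventually in even `L`;
* `stub_noSag`     — NO SAG: the GS-average block intensity exceeds the torus intensity by at most `ε`,
  `A_{Λ,L} - Y_L ≤ ε`, for `Λ ≥ Λ₀(ε)`, eventually in even `L`;
* `stub_budget`    — DEGENERACY BUDGET: `re tr P_{E₀(U,L)} ≤ D` eventually in even `L`, for some `D`;
give, by the budgeted two-scale domination inequality (★) (`twoScaleTransferAt`), the eventual bound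
`(c/2) L⁴ ≤ re ⟨ψ, Δ_d†Δ_d ψ⟩` for EVERY unit sector ground state, hence the crux through the socket
`birEveryGroundState_structural_of_transfer`. All three stubs are stated at one coupling under the average
bound at that coupling (the only hypothesis the crux offers); they are the card's `BlockRigidityAt`, `NoSagAt`,
`DegeneracyBudgetAt` made conditional on `AvgHyp`.
-/

noncomputable section

set_option linter.dupNamespace false

namespace Summit.HubbardSuperconductivity.HubbardSuperconductivity.Cruxes.BirEveryGroundState.TwoScaleDomination

open Matrix Finset Filter
open scoped ComplexOrder
open Literature.Probability.LatticeModels Literature.MathematicalPhysics.QuantumLattice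
open Summit.HubbardSuperconductivity.HubbardSuperconductivity.Theorems
open Summit.HubbardSuperconductivity.HubbardSuperconductivity.Theses.BalabanIR

/-! ## Stubs -/

/-- STUB (engine-grade, OPEN): BLOCK RIGIDITY of the GS-average under the average bound. At a coupling
`U > 0` and doping `δ ∈ (0,1/2)` where the GS-average of `Δ_d†Δ_d` is eventually `≥ c L⁴`, the GS-average
block VARIANCE of the block pair intensities `(m_Λ x)ᴴ (m_Λ x)`, `m_Λ(x) = Λ⁻² Σ_{v∈[0,Λ)²} P_{x+v}`, is
`≤ ε` for all block scales `Λ ≥ Λ₀(ε)`, eventually in even `L`. A clustering / Griffiths-type correlation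
inequality for sector ground states of doped repulsive Hubbard tori; NOT in print; not implied by the bare
average bound. -/
theorem stub_rigidity : ∀ δ ∈ Set.Ioo (0:ℝ) (1/2), ∀ U : ℝ, 0 < U → ∀ c : ℝ, 0 < c →
    (∃ L₀ : ℕ, ∀ (L : ℕ) [NeZero L], L₀ ≤ L → Even L →
      let N : ℕ := 2 * ⌊(1 - δ) * (L : ℝ) ^ 2 / 2⌋₊
      let H := hubbardTorus 2 L 1 U
      let S := szSector (Λ := FermionTorus 2 L) N 0
      let E₀ := S ⊓ Module.End.eigenspace (Matrix.toLin' H) ((H.minEnergyOn S : ℝ) : ℂ)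
      let P := projMatrix (E₀.map (Fock.toEuclidean (ι := Orb (FermionTorus 2 L)) :
        Fock (Orb (FermionTorus 2 L)) →ₗ[ℂ] EuclideanSpace ℂ (Finset (Orb (FermionTorus 2 L)))))
      c * (L : ℝ) ^ 4 * P.trace.re ≤
        (P * ((pairField dWaveFormFactor L)ᴴ * pairField dWaveFormFactor L)).trace.re) →
    ∀ ε > 0, ∃ Λ₀ : ℕ, ∀ Λ ≥ Λ₀, ∃ L₀ : ℕ, ∀ (L : ℕ) [NeZero L], L₀ ≤ L → Even L →
      let N : ℕ := 2 * ⌊(1 - δ) * (L : ℝ) ^ 2 / 2⌋₊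
      let H := hubbardTorus 2 L 1 U
      let S := szSector (Λ := FermionTorus 2 L) N 0
      let E₀ := S ⊓ Module.End.eigenspace (Matrix.toLin' H) ((H.minEnergyOn S : ℝ) : ℂ)
      let P := projMatrix (E₀.map (Fock.toEuclidean (ι := Orb (FermionTorus 2 L)) :
        Fock (Orb (FermionTorus 2 L)) →ₗ[ℂ] EuclideanSpace ℂ (Finset (Orb (FermionTorus 2 L)))))
      let d : ℝ := P.trace.re
      let m := fun x : TorusSite 2 L => (((Λ : ℂ)) ^ 2)⁻¹ • ∑ v : Fin Λ × Fin Λ,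
        localPair dWaveFormFactor L (x + ![((v.1 : ℕ) : ZMod L), ((v.2 : ℕ) : ZMod L)])
      let A : ℝ := (∑ x, (P * ((m x)ᴴ * m x)).trace.re) / ((L : ℝ) ^ 2 * d)
      let V : ℝ := (∑ x, (P * (((m x)ᴴ * m x - (A : ℂ) • 1) *
        ((m x)ᴴ * m x - (A : ℂ) • 1))).trace.re) / ((L : ℝ) ^ 2 * d)
      V ≤ ε := by
  sorry

/-- STUB (engine-grade, OPEN): NO SAG of the GS-average under the average bound. At a coupling `U > 0`
and doping `δ ∈ (0,1/2)` where the GS-average of `Δ_d†Δ_d` is eventually `≥ c L⁴`, the GS-average block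
intensity `A_{Λ,L}` exceeds the torus intensity `Y_L = re tr(P Δ_d†Δ_d)/(L⁴ re tr P)` by at most `ε` for
`Λ ≥ Λ₀(ε)`, eventually in even `L` (block order does not overshoot torus order: no wound / modulated
condensate in the GS-average). Engine-type two-scale inequality; NOT in print. -/
theorem stub_noSag : ∀ δ ∈ Set.Ioo (0:ℝ) (1/2), ∀ U : ℝ, 0 < U → ∀ c : ℝ, 0 < c →
    (∃ L₀ : ℕ, ∀ (L : ℕ) [NeZero L], L₀ ≤ L → Even L →
      let N : ℕ := 2 * ⌊(1 - δ) * (L : ℝ) ^ 2 / 2⌋₊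
      let H := hubbardTorus 2 L 1 U
      let S := szSector (Λ := FermionTorus 2 L) N 0
      let E₀ := S ⊓ Module.End.eigenspace (Matrix.toLin' H) ((H.minEnergyOn S : ℝ) : ℂ)
      let P := projMatrix (E₀.map (Fock.toEuclidean (ι := Orb (FermionTorus 2 L)) :
        Fock (Orb (FermionTorus 2 L)) →ₗ[ℂ] EuclideanSpace ℂ (Finset (Orb (FermionTorus 2 L)))))
      c * (L : ℝ) ^ 4 * P.trace.re ≤
        (P * ((pairField dWaveFormFactor L)ᴴ * pairField dWaveFormFactor L)).trace.re) →
    ∀ ε > 0, ∃ Λ₀ : ℕ, ∀ Λ ≥ Λ₀, ∃ L₀ : ℕ, ∀ (L : ℕ) [NeZero L], L₀ ≤ L → Even L →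
      let N : ℕ := 2 * ⌊(1 - δ) * (L : ℝ) ^ 2 / 2⌋₊
      let H := hubbardTorus 2 L 1 U
      let S := szSector (Λ := FermionTorus 2 L) N 0
      let E₀ := S ⊓ Module.End.eigenspace (Matrix.toLin' H) ((H.minEnergyOn S : ℝ) : ℂ)
      let P := projMatrix (E₀.map (Fock.toEuclidean (ι := Orb (FermionTorus 2 L)) :
        Fock (Orb (FermionTorus 2 L)) →ₗ[ℂ] EuclideanSpace ℂ (Finset (Orb (FermionTorus 2 L)))))
      let d : ℝ := P.trace.re
      let m := fun x : TorusSite 2 L => (((Λ : ℂ)) ^ 2)⁻¹ • ∑ v : Fin Λ × Fin Λ,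
        localPair dWaveFormFactor L (x + ![((v.1 : ℕ) : ZMod L), ((v.2 : ℕ) : ZMod L)])
      let A : ℝ := (∑ x, (P * ((m x)ᴴ * m x)).trace.re) / ((L : ℝ) ^ 2 * d)
      let Y : ℝ := (P * ((pairField dWaveFormFactor L)ᴴ * pairField dWaveFormFactor L)).trace.re /
        ((L : ℝ) ^ 4 * d)
      A - Y ≤ ε := by
  sorry

/-- STUB (exact-spectral conjecture, OPEN): DEGENERACY BUDGET under the average bound. At a coupling
`U > 0` and doping `δ ∈ (0,1/2)` where the GS-average of `Δ_d†Δ_d` is eventually `≥ c L⁴`, the sector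
ground degeneracy `re tr P_{E₀(U,L)} = dim E₀(U,L)` is eventually bounded by a constant `D`. A ground-state
degeneracy theorem for doped repulsive Hubbard tori; NOT in print (Lieb 1989 covers `U < 0` / half filling). -/
theorem stub_budget : ∀ δ ∈ Set.Ioo (0:ℝ) (1/2), ∀ U : ℝ, 0 < U → ∀ c : ℝ, 0 < c →
    (∃ L₀ : ℕ, ∀ (L : ℕ) [NeZero L], L₀ ≤ L → Even L →
      let N : ℕ := 2 * ⌊(1 - δ) * (L : ℝ) ^ 2 / 2⌋₊
      let H := hubbardTorus 2 L 1 U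
      let S := szSector (Λ := FermionTorus 2 L) N 0
      let E₀ := S ⊓ Module.End.eigenspace (Matrix.toLin' H) ((H.minEnergyOn S : ℝ) : ℂ)
      let P := projMatrix (E₀.map (Fock.toEuclidean (ι := Orb (FermionTorus 2 L)) :
        Fock (Orb (FermionTorus 2 L)) →ₗ[ℂ] EuclideanSpace ℂ (Finset (Orb (FermionTorus 2 L)))))
      c * (L : ℝ) ^ 4 * P.trace.re ≤
        (P * ((pairField dWaveFormFactor L)ᴴ * pairField dWaveFormFactor L)).trace.re) →
    ∃ D : ℝ, ∃ L₀ : ℕ, ∀ (L : ℕ) [NeZero L], L₀ ≤ L → Even L →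
      let N : ℕ := 2 * ⌊(1 - δ) * (L : ℝ) ^ 2 / 2⌋₊
      let H := hubbardTorus 2 L 1 U
      let S := szSector (Λ := FermionTorus 2 L) N 0
      let E₀ := S ⊓ Module.End.eigenspace (Matrix.toLin' H) ((H.minEnergyOn S : ℝ) : ℂ)
      let P := projMatrix (E₀.map (Fock.toEuclidean (ι := Orb (FermionTorus 2 L)) :
        Fock (Orb (FermionTorus 2 L)) →ₗ[ℂ] EuclideanSpace ℂ (Finset (Orb (FermionTorus 2 L)))))
      let d : ℝ := P.trace.re
      d ≤ D := by
  sorry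

/-! ## Composition -/

/-- THE LINE: the three stubs imply the crux `BirEveryGroundState` BY NAME (take the midpoint of the
window; the landed closer `birEveryGroundState_structural_of_twoScale` does the rest). -/
theorem BirEveryGroundState_of : BirEveryGroundState := by
  refine birEveryGroundState_structural_of_twoScale fun δ U₁ U₂ c hδ hU₁ hU₁₂ hc havg => ?_
  have hUmem : (U₁ + U₂) / 2 ∈ Set.Ioo U₁ U₂ := by constructor <;> linarith
  have hU : 0 < (U₁ + U₂) / 2 := by linarith
  have havgU := havg _ hUmem
  obtain ⟨D, hD⟩ := stub_budget δ hδ _ hU c hc havgU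
  exact ⟨(U₁ + U₂) / 2, hUmem, D, stub_rigidity δ hδ _ hU c hc havgU, stub_noSag δ hδ _ hU c hc havgU, hD⟩

end Summit.HubbardSuperconductivity.HubbardSuperconductivity.Cruxes.BirEveryGroundState.TwoScaleDomination
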